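import Summits.HodgeConjecture.HodgeConjecture.Theorems.SixfoldTableXCensusWeilCMGeneralRows
import Literature.AlgebraicGeometry.HodgeTheory.WeilTypeHodgeRingOfCentralizerDetOneGeneral
import HarnessLib

/-!
# TABLE X (dimension 6) — ALL Weil carriers with `K` central in `End⁰(A)` (in particular the square-product rows 20 `E_K² × Y₄(3,1)`
# and 27 `E_K² × Y₄/M`, `End⁰ ⊇ M₂(K)`), GENERAL MEMBERS: the census nodes X2 / X1 IN THE KERNEL under the displayed group
# hypothesis «`Hg(A) ⊇ S(A)(ℂ) ∩ SU_K`», domain membership displayed (cell `pub-hodgeav-hg6`, req-37 (A) Q2b; eng-4 g6, L18;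
# lead g2 2026-08-29T00:51:12Z)

HONEST FRAMING. HC, `HC_AV` (stmt-1333), `HC_CM` (stmt-3052) and H2 are NOT proved and do not occur. X2 / X1 stay `@[conjecture]`
(OURS); R-W6 and Markman₆ appear only as displayed hypotheses of §2; the GROUP hypothesis (general member) and the domain
membership `¬ 𝒞 A` are DISPLAYED. KERNEL ONLY: theorems over existing declarations; no definition, no `sorry`, no named fact.

WHY THIS MODULE. L16 / L16b / L17 (rows 11, 13, 17, 19, 22) consumed W1
(`isDivisorWeilGenerated_of_hodgeGroup_ge_unitaryCentralizer_detOne`), which needs Milne's SINGLE-GENERATOR description of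
`C(A) ⊗ ℂ` — unavailable for rows 20 / 27 (`E_K²` factor, `End⁰ ⊇ M₂(K)`; J1 ×2: row 20 «2 (t: scalar) ⊕ 4 (sl), 2a₁ + 4a₂ = 0»,
`exc = (0,0,2,0,0)`; row 27 `exc₃ = 2`, `B³ − D³ = 18 − 16` — the `W_K` pattern again). W1G
(`HodgeTheory/WeilTypeHodgeRingOfCentralizerDetOneGeneral.isDivisorWeilGenerated_of_hodgeGroup_ge_unitaryCentralizer_detOne_general`)
replaces that input by Milne's Cor. 4.5 for EVERY complex abelian variety (tree `Milne1999.mem_divisorClassesSpan_of_forall_mem_unitaryCentralizerGroup`):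
hypotheses `h ∈ B¹(A) ⊗ ℂ` with `Q_h` non-degenerate, `φ^*` CENTRAL (`K` in the centre of `End⁰(A)`: true for `E_K² × Y`, `K`
acting diagonally) and a `d`-similitude of `Q_h`, and the group hypothesis. This file is the census wrapper in that generality:
* §1 **`WeilERows.census_weilType_detOne_general`** (+ `_of_isIsogenous`) — `(A, φ)` of Weil type `(3, d)`, `¬ 𝒞 A` (displayed; for
  row 20 it follows from the simple factors `{E_K, Y₄}` having no quartic-CM fourfold; for row 27 — `Y₄/M` IS a quartic-CM type-IV
  fourfold and `E_K²` is a CM surface — membership in the nodes' domain must be CHECKED against the definition of `𝒞` by the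
  record keeper before booking), `hh`, `hnd`, `hφC`, `hφQ`, `hG` ⟹ `(dim A = 6 ∧ ¬ 𝒞 A) ∧` X2-at-`A` `∧` X1-at-`A`.
* §2 `WeilERows.hodgeConjectureFor_weilType_detOne_general_of_weilSixfolds / _of_markman₆_nonsplit / _of_isIsogenous_…` — HC from
  {Markman₆, R-W6} alone (no domain hypothesis).
NOT COVERED: special members; the positivity facts; inhabitants; typed ≠ proved.
-/

set_option linter.dupNamespace false

noncomputable section

open CategoryTheory
open Literature.AlgebraicGeometry Literature.AlgebraicGeometry.Motives
open Literature.AlgebraicGeometry.Motives.AbelianVariety (IsIsogenous IsSimple)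
open Literature.AlgebraicGeometry.HodgeTheory
open Literature.AlgebraicGeometry.Milne1999
open Literature.AlgebraicGeometry.VanGeemen1994 (pullbackOne hodgeGroupOne detOnEigenspace)
open Literature.AlgebraicTopology.SingularHomology
open Literature.Barriers.HodgeConjecture
open Summit.HodgeConjecture.HodgeConjecture.Ring2.ClassTargets
open Summit.HodgeConjecture.HodgeConjecture.Ring2.Motiv (ProdCMCell)
open Summit.HodgeConjecture.HodgeConjecture.Ring2.Atlas (IsQuarticFieldTypeIVFourfold)

namespace Summit.HodgeConjecture.HodgeConjecture.TableX.WeilERows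

variable (A : AbelianVariety ℂ) (φ : A ⟶ A) (d : ℕ)

variable {h : complexBetti A.X 2}

/-! ## §1 General Weil carriers (any `End⁰` with `K` central), general member: both census conclusions, in the kernel -/

variable {h : complexBetti A.X 2}

/-- **TABLE X ROWS 11 `g6.IV(2,1).kE0` / 13 `g6.IV(3,1).kE0`, GENERAL MEMBER, KERNEL VERDICT WITH DOMAIN MEMBERSHIP.** For a
complex abelian sixfold `A` with `(A, φ)` of Weil type `(3, d)` (`φ² = -d`, `K = ℚ(φ)` acting with multiplicities `(3,3)`),
`A` SIMPLE and NOT of CM type, a rational class `h` with a Kähler multiple whose polarization pairing `Q_h` has `φ^*` as a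
`d`-similitude, Milne's single-generator data (`C(A) ⊗ ℂ` = commutant of one diagonalisable `φ_E^*` with `Q_h`-adjoint `J'` in
the bicommutant: `End⁰(A) = E = ℚ(φ_E)` a CM field ⊋ K), and the DISPLAYED general-member hypothesis «every
`u ∈ S(A)(ℂ) = unitaryCentralizerGroup A h` with `det(u | W) = 1` lies in `hodgeGroupOne A.dim A.X`» (`Hg ⊇ U_E ∩ SU_K`):
`dim A = 6 ∧ ¬ 𝒞 A` (L7 `not_residueClass_of_isSimple_of_not_isOfCMType`), AND X2-at-`A` (`B² ⊆ D² ⊗ ℂ`: the divisor summand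
alone) AND X1-at-`A` (`B³ ⊆ D³ ⊗ ℂ ⊔ W_K ⊗ ℂ`, §1: the divisor summand and the sixfold-Weil summand) — by
`isDivisorWeilGenerated_of_hodgeGroup_ge_unitaryCentralizer_detOne`. General member only: special members NOT covered;
HC / HC_AV NOT proved. [cite: Milne1999LefschetzClasses, Thm. 3.2 and Cor. 4.5] [cite: vanGeemen1994HodgeAV, Thm. 6.12 and 4.9]
[cite: MoonenZarhin1999LowDim, (1.9) and (2.3)] [cite: MoonenZarhin1998WeilClasses, §1] -/
theorem census_weilType_detOne_general (hW : IsWeilType A φ 3 d)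
    (hdom : ¬ (IsOfCMType A ∨ ProdCMCell IsQuarticFieldTypeIVFourfold (fun Z ↦ Z.dim = 2) A))
    (hh : h ∈ VanGeemen1994.hodgeClassSpan A.dim A.X 1)
    (hnd : ∀ x : complexBetti A.X 1, (∀ y, polarizationPairingOne A.X h (A.dim - 1) x y = 0) → x = 0)
    (hφC : pullbackOne A φ ∈ centralizerAlgebra A)
    (hφQ : ∀ x y, polarizationPairingOne A.X h (A.dim - 1) (pullbackOne A φ x) (pullbackOne A φ y) =
      (d : ℂ) • polarizationPairingOne A.X h (A.dim - 1) x y)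
    (hG : ∀ (u : complexBetti A.X 1 ≃ₗ[ℂ] complexBetti A.X 1) (hu : u ∈ unitaryCentralizerGroup A h),
      detOnEigenspace u (pullbackOne A φ) (fun x ↦ (mem_centralizerGroup_iff.1 hu.1) φ x)
        (Complex.I * (Real.sqrt d : ℂ)) = 1 → u ∈ hodgeGroupOne A.dim A.X) :
    (A.dim = 6 ∧ ¬ (IsOfCMType A ∨ ProdCMCell IsQuarticFieldTypeIVFourfold (fun Z ↦ Z.dim = 2) A)) ∧
    (∀ c : complexBetti A.X (2 * 2), IsRationalClass c → IsOfHodgeType A.dim A.X (2 * 2) 2 2 c →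
      c ∈ divisorClassesSpan A.X A.dim 2 ⊔ Submodule.span ℂ {w' : complexBetti A.X (2 * 2) |
        ∃ (C : AbelianVariety ℂ) (g : A.X ⟶ C.X) (w : complexBetti C.X (2 * 2)), C.dim < A.dim ∧
          IsRationalClass w ∧ IsOfHodgeType C.dim C.X (2 * 2) 2 2 w ∧ w' = complexBetti.map g (2 * 2) w}) ∧
    (∀ c : complexBetti A.X (2 * 3), IsRationalClass c → IsOfHodgeType A.dim A.X (2 * 3) 3 3 c →
      c ∈ divisorClassesSpan A.X A.dim 3 ⊔ Submodule.span ℂ {w' : complexBetti A.X (2 * 3) |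
          ∃ (a : complexBetti A.X (2 * 2)) (b : complexBetti A.X (2 * 1)),
            IsRationalClass a ∧ IsOfHodgeType A.dim A.X (2 * 2) 2 2 a ∧ IsRationalClass b ∧
            IsOfHodgeType A.dim A.X (2 * 1) 1 1 b ∧ w' = cupProduct (two_mul_add_two_mul 2 1) a b} ⊔
        Submodule.span ℂ {w' : complexBetti A.X (2 * 3) |
          ∃ (C : AbelianVariety ℂ) (g : A.X ⟶ C.X) (w : complexBetti C.X (2 * 3)), C.dim < A.dim ∧
            IsRationalClass w ∧ IsOfHodgeType C.dim C.X (2 * 3) 3 3 w ∧ w' = complexBetti.map g (2 * 3) w} ⊔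
        Submodule.span ℂ {w' : complexBetti A.X (2 * 3) |
          ∃ (B' : AbelianVariety ℂ) (g : A.X ⟶ B'.X) (d : ℕ) (ψ : B' ⟶ B') (w : complexBetti B'.X (2 * 3)),
            B'.dim = 6 ∧ 0 < d ∧ ψ ≫ ψ = -(d • 𝟙 B') ∧ IsRationalClass w ∧
            IsOfHodgeType B'.dim B'.X (2 * 3) 3 3 w ∧ w ∈ weilClassesOf B' ψ 3 d ∧
            w' = complexBetti.map g (2 * 3) w}) := by
  obtain ⟨hBD, hB3⟩ := isDivisorWeilGenerated_of_hodgeGroup_ge_unitaryCentralizer_detOne_general A φ (by norm_num)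
    hW.dim_eq hW.d_pos hW.sq_eq hh hnd hφC hφQ hG
  refine ⟨⟨by rw [hW.dim_eq], hdom⟩, fun c hcQ hcH ↦ ?_,
    fun c hcQ hcH ↦ ?_⟩
  · exact Submodule.mem_sup_left (hBD 2 c (by norm_num) hcQ hcH)
  · obtain ⟨x, hx, y, hy, rfl⟩ := Submodule.mem_sup.1 (hB3 c hcQ hcH)
    exact Submodule.add_mem _ (Submodule.mem_sup_left (Submodule.mem_sup_left (Submodule.mem_sup_left hx)))
      (Submodule.mem_sup_right (weilClassesOf_le_weilSummand_of_isWeilType A φ d hW hy))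

/-- **Rows 11 / 13, general member, on the whole ISOGENY CLASS**: everything isogenous to such an `A` is in the nodes'
domain and satisfies both census conclusions (L7 `offResidueSix_iff_of_isIsogenous`, L7b
`codimTwo/ThreeCensusAt_iff_of_isIsogenous`). General member only. [cite: Milne1999LefschetzClasses, Thm. 3.2 and Cor. 4.5]
[cite: vanGeemen1994HodgeAV, Thm. 6.12 and Lemma 3.7] [cite: MoonenZarhin1999LowDim, §5 (5.1)] -/
theorem census_weilType_detOne_general_of_isIsogenous {A' : AbelianVariety ℂ} (hW : IsWeilType A φ 3 d)
    (hdom : ¬ (IsOfCMType A ∨ ProdCMCell IsQuarticFieldTypeIVFourfold (fun Z ↦ Z.dim = 2) A))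
    (hh : h ∈ VanGeemen1994.hodgeClassSpan A.dim A.X 1)
    (hnd : ∀ x : complexBetti A.X 1, (∀ y, polarizationPairingOne A.X h (A.dim - 1) x y = 0) → x = 0)
    (hφC : pullbackOne A φ ∈ centralizerAlgebra A)
    (hφQ : ∀ x y, polarizationPairingOne A.X h (A.dim - 1) (pullbackOne A φ x) (pullbackOne A φ y) =
      (d : ℂ) • polarizationPairingOne A.X h (A.dim - 1) x y)
    (hG : ∀ (u : complexBetti A.X 1 ≃ₗ[ℂ] complexBetti A.X 1) (hu : u ∈ unitaryCentralizerGroup A h),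
      detOnEigenspace u (pullbackOne A φ) (fun x ↦ (mem_centralizerGroup_iff.1 hu.1) φ x)
        (Complex.I * (Real.sqrt d : ℂ)) = 1 → u ∈ hodgeGroupOne A.dim A.X)
    (hA'A : IsIsogenous A' A) :
    (A'.dim = 6 ∧ ¬ (IsOfCMType A' ∨ ProdCMCell IsQuarticFieldTypeIVFourfold (fun Z ↦ Z.dim = 2) A')) ∧
    (∀ c : complexBetti A'.X (2 * 2), IsRationalClass c → IsOfHodgeType A'.dim A'.X (2 * 2) 2 2 c →
      c ∈ divisorClassesSpan A'.X A'.dim 2 ⊔ Submodule.span ℂ {w' : complexBetti A'.X (2 * 2) |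
        ∃ (C : AbelianVariety ℂ) (g : A'.X ⟶ C.X) (w : complexBetti C.X (2 * 2)), C.dim < A'.dim ∧
          IsRationalClass w ∧ IsOfHodgeType C.dim C.X (2 * 2) 2 2 w ∧ w' = complexBetti.map g (2 * 2) w}) ∧
    (∀ c : complexBetti A'.X (2 * 3), IsRationalClass c → IsOfHodgeType A'.dim A'.X (2 * 3) 3 3 c →
      c ∈ divisorClassesSpan A'.X A'.dim 3 ⊔ Submodule.span ℂ {w' : complexBetti A'.X (2 * 3) |
          ∃ (a : complexBetti A'.X (2 * 2)) (b : complexBetti A'.X (2 * 1)),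
            IsRationalClass a ∧ IsOfHodgeType A'.dim A'.X (2 * 2) 2 2 a ∧ IsRationalClass b ∧
            IsOfHodgeType A'.dim A'.X (2 * 1) 1 1 b ∧ w' = cupProduct (two_mul_add_two_mul 2 1) a b} ⊔
        Submodule.span ℂ {w' : complexBetti A'.X (2 * 3) |
          ∃ (C : AbelianVariety ℂ) (g : A'.X ⟶ C.X) (w : complexBetti C.X (2 * 3)), C.dim < A'.dim ∧
            IsRationalClass w ∧ IsOfHodgeType C.dim C.X (2 * 3) 3 3 w ∧ w' = complexBetti.map g (2 * 3) w} ⊔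
        Submodule.span ℂ {w' : complexBetti A'.X (2 * 3) |
          ∃ (B' : AbelianVariety ℂ) (g : A'.X ⟶ B'.X) (d : ℕ) (ψ : B' ⟶ B') (w : complexBetti B'.X (2 * 3)),
            B'.dim = 6 ∧ 0 < d ∧ ψ ≫ ψ = -(d • 𝟙 B') ∧ IsRationalClass w ∧
            IsOfHodgeType B'.dim B'.X (2 * 3) 3 3 w ∧ w ∈ weilClassesOf B' ψ 3 d ∧
            w' = complexBetti.map g (2 * 3) w}) := by
  obtain ⟨hdom, h2, h3⟩ := census_weilType_detOne_general A φ d hW hdom hh hnd hφC hφQ hG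
  exact ⟨(offResidueSix_iff_of_isIsogenous hA'A).mpr hdom, (codimTwoCensusAt_iff_of_isIsogenous hA'A).mpr h2,
    (codimThreeCensusAt_iff_of_isIsogenous hA'A).mpr h3⟩

/-! ## §2 HC for the general Weil member from the named residues alone -/

/-- **HC for the general member of rows 11 / 13 from the ladder item `WeilSixfolds` ALONE** (no census node, no Markman₄, no
`HC_CM`): under the displayed group hypothesis `B• ⊆ D• + W_K` (`IsDivisorWeilGenerated`), the divisor ring is algebraic by
Lefschetz (1,1) (`lefschetzOneOne_rational_holds`, `AbelianVariety.divisorClassesSpan_le_algebraicClasses`), and `WeilSixfolds`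
(`SevenfoldWeilCensus.WeilSixfolds`, stmt-HodgeConjecture-2524, read on `weilClassesOf` by
`WeilTypeLadder.weilSixfolds_iff_weilClassesOf`) makes the rational `(3,3)` Weil classes of `(A, φ)` algebraic; assemble with
`hodgeConjectureFor_of_isDivisorWeilGenerated`. The binder is displayed, not asserted.
[cite: vanGeemen1994HodgeAV, 2.4 and Thm. 6.12] [cite: Milne1999LefschetzClasses, Cor. 4.5] [cite: MoonenZarhin1999LowDim, Thm. 0.2] -/
theorem hodgeConjectureFor_weilType_detOne_general_of_weilSixfolds (hW₆ : Theses.SevenfoldWeilCensus.WeilSixfolds)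
    (hW : IsWeilType A φ 3 d)
    (hh : h ∈ VanGeemen1994.hodgeClassSpan A.dim A.X 1)
    (hnd : ∀ x : complexBetti A.X 1, (∀ y, polarizationPairingOne A.X h (A.dim - 1) x y = 0) → x = 0)
    (hφC : pullbackOne A φ ∈ centralizerAlgebra A)
    (hφQ : ∀ x y, polarizationPairingOne A.X h (A.dim - 1) (pullbackOne A φ x) (pullbackOne A φ y) =
      (d : ℂ) • polarizationPairingOne A.X h (A.dim - 1) x y)
    (hG : ∀ (u : complexBetti A.X 1 ≃ₗ[ℂ] complexBetti A.X 1) (hu : u ∈ unitaryCentralizerGroup A h),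
      detOnEigenspace u (pullbackOne A φ) (fun x ↦ (mem_centralizerGroup_iff.1 hu.1) φ x)
        (Complex.I * (Real.sqrt d : ℂ)) = 1 → u ∈ hodgeGroupOne A.dim A.X) :
    HodgeConjectureFor A.dim A.X := by
  have hDW := isDivisorWeilGenerated_of_hodgeGroup_ge_unitaryCentralizer_detOne_general A φ (by norm_num)
    hW.dim_eq hW.d_pos hW.sq_eq hh hnd hφC hφQ hG
  have h11 : ∀ b : complexBetti A.X (2 * 1), IsRationalClass b → IsOfHodgeType A.dim A.X (2 * 1) 1 1 b →
      b ∈ algebraicClasses A.X 1 :=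
    fun b hb hb' ↦ lefschetzOneOne_rational_holds (AbelianVariety.isSmoothProjective_holds (A := A)) b hb hb'
  refine hodgeConjectureFor_of_isDivisorWeilGenerated hW hDW (AbelianVariety.divisorClassesSpan_le_algebraicClasses A h11)
    fun c hcW hcQ hcH ↦ ?_
  exact WeilTypeLadder.weilSixfolds_iff_weilClassesOf.mp hW₆ d hW.d_pos A φ hW.dim_eq hW.isSmoothProjective hW.sq_eq c
    hcQ hcH hcW

/-- **HC for the general member of rows 11 / 13 from the NAMED RESIDUES {Markman₆, R-W6} ALONE.** GRANTED Markman's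
hyperbolic-sixfold theorem (`Markman2025_weilClasses_algebraic_hyperbolicSixfold`, arXiv:2502.03415 Thm. 1.5.1, preprint,
UNREFEREED; the split / discriminant-`−1` range) and the residue R-W6 = `WeilTypeLadder.NonsplitSixfolds` (OPEN), every
sixfold's rational `(3,3)` Weil classes are algebraic (`WeilTypeLadder.weilSixfolds_of_nonsplitSixfolds_of_floor`), hence HC
holds at every such `A` (previous theorem). Neither displayed hypothesis is asserted; the algebraicity of Weil classes is not
touched; the group hypothesis is the general member only. [cite: Markman2025SecantWeil, Thm. 1.5.1 (preprint, unrefereed)]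
[claim: Markman2025SurveySecant, status: under-review] [cite: vanGeemen1994HodgeAV, Thm. 6.12] [cite: Milne1999LefschetzClasses, Cor. 4.5] -/
theorem hodgeConjectureFor_weilType_detOne_general_of_markman₆_nonsplit
    (hMark₆ : Markman2025_weilClasses_algebraic_hyperbolicSixfold) (hRW6 : WeilTypeLadder.NonsplitSixfolds)
    (hW : IsWeilType A φ 3 d)
    (hh : h ∈ VanGeemen1994.hodgeClassSpan A.dim A.X 1)
    (hnd : ∀ x : complexBetti A.X 1, (∀ y, polarizationPairingOne A.X h (A.dim - 1) x y = 0) → x = 0)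
    (hφC : pullbackOne A φ ∈ centralizerAlgebra A)
    (hφQ : ∀ x y, polarizationPairingOne A.X h (A.dim - 1) (pullbackOne A φ x) (pullbackOne A φ y) =
      (d : ℂ) • polarizationPairingOne A.X h (A.dim - 1) x y)
    (hG : ∀ (u : complexBetti A.X 1 ≃ₗ[ℂ] complexBetti A.X 1) (hu : u ∈ unitaryCentralizerGroup A h),
      detOnEigenspace u (pullbackOne A φ) (fun x ↦ (mem_centralizerGroup_iff.1 hu.1) φ x)
        (Complex.I * (Real.sqrt d : ℂ)) = 1 → u ∈ hodgeGroupOne A.dim A.X) :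
    HodgeConjectureFor A.dim A.X :=
  hodgeConjectureFor_weilType_detOne_general_of_weilSixfolds A φ d
    (WeilTypeLadder.weilSixfolds_of_nonsplitSixfolds_of_floor hMark₆ hRW6) hW hh hnd hφC hφQ hG

/-- **… and on the whole isogeny class** (van Geemen Lemma 3.7 = `HodgeConjectureFor.of_isIsogenous`).
[cite: vanGeemen1994HodgeAV, Lemma 3.7 and Thm. 6.12] [cite: Markman2025SecantWeil, Thm. 1.5.1 (preprint, unrefereed)] -/
theorem hodgeConjectureFor_of_isIsogenous_weilType_detOne_general_of_markman₆_nonsplit {A' : AbelianVariety ℂ}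
    (hMark₆ : Markman2025_weilClasses_algebraic_hyperbolicSixfold) (hRW6 : WeilTypeLadder.NonsplitSixfolds)
    (hW : IsWeilType A φ 3 d)
    (hh : h ∈ VanGeemen1994.hodgeClassSpan A.dim A.X 1)
    (hnd : ∀ x : complexBetti A.X 1, (∀ y, polarizationPairingOne A.X h (A.dim - 1) x y = 0) → x = 0)
    (hφC : pullbackOne A φ ∈ centralizerAlgebra A)
    (hφQ : ∀ x y, polarizationPairingOne A.X h (A.dim - 1) (pullbackOne A φ x) (pullbackOne A φ y) =
      (d : ℂ) • polarizationPairingOne A.X h (A.dim - 1) x y)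
    (hG : ∀ (u : complexBetti A.X 1 ≃ₗ[ℂ] complexBetti A.X 1) (hu : u ∈ unitaryCentralizerGroup A h),
      detOnEigenspace u (pullbackOne A φ) (fun x ↦ (mem_centralizerGroup_iff.1 hu.1) φ x)
        (Complex.I * (Real.sqrt d : ℂ)) = 1 → u ∈ hodgeGroupOne A.dim A.X)
    (hA'A : IsIsogenous A' A) : HodgeConjectureFor A'.dim A'.X :=
  HodgeConjectureFor.of_isIsogenous hA'A
    (hodgeConjectureFor_weilType_detOne_general_of_markman₆_nonsplit A φ d hMark₆ hRW6 hW hh hnd hφC hφQ hG)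

end Summit.HodgeConjecture.HodgeConjecture.TableX.WeilERows
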